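import Summits.ABC.IUTFork.Cor312ProvenanceFrames
import Summits.ABC.IUTFork.Cor312WeightSums
import Summits.ABC.IUTFork.Cor312Bridge
import Literature.IUT.LogVolume.LocalFieldEmbeddings
import Literature.IUT.LogVolume.FundamentalIdentity
import Literature.IUT.LogVolume.LocalDegreeBridge
import Literature.IUT.LogVolume.Corollary22TwoAdicIntegrality
import HarnessLib

/-!
# [IUTchIII] Cor. 3.12 — the provenance link `IsSettingOf D P` for the assembled real setting over volume frames:
# the GENUINE instantiation of its free binders (Haar factor volumes, verbatim weights, `2l`-th roots of `q`)
# (c312 crew, wave 2, board row W2-F′; ADJUDICATION-SPEC §4 (iii))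

Record-only PROOF companion (seat abc-iut-c312-8, gen 2); TAKES NO SIDE on [IUTchIII] Cor. 3.12. `Cor312ProvenanceFrames`
(`isSettingOf_ofFrames`, p412742; degree-weighted shape note p413845 / audit F-w5d158-1) gives the §4 (iii) provenance
witness `IsSettingOf D (Setting.ofFrames …)` for abc-iut-c312-7's per-place assembler over abc-iut-c312-6's
`FrameVolumePieces`, MODULO three properties (hmarg)/(hbad)/(hgood) of FREE binders: the weights `V.w`, the factor volumes
`V.vol`, the `q`-pilot centre `qCentre`, an assignment `π` of field factors to places of `F_mod` and a normalisation `Pr`.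
THIS FILE discharges them down to the GENUINE local data, i.e. proves that the printed choices satisfy them:

* §1 `ofUltrametric_mulLogvol_eq_finrank_mul_log` — at a `p`-adic field factor `K` with the Haar factor
  volume of [AbsTopIII] Prop. 5.7 (i) (`Cor312Vol.FactorVolume.ofUltrametric`, `μ(𝒪_K) = 1`):
  `μ̇^log_K(c) = [K:ℚ_p]·log ‖c‖` (abc-iut-S8 `mulLogVolume_eq_mul_log_norm` + the fundamental identity `e·f = [K:ℚ_p]`);
  hence `μ̇^log_K(c) = ([K:ℚ_p]/N)·log ‖y‖⁻¹` when `‖c‖^N·‖y‖ = 1` (`…_of_norm_pow_mul_norm_eq_one`).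
* §2 `log_norm_rescaledCompletion_embedding` — in abc-iut-S7's rescaled completion `(F₀)_w` (`‖·‖ = N(w)^{−ord_w/n_w}`,
  `n_w = [(F₀)_w:ℚ_p]`): `log ‖x‖ = −ord_w(x)·log N(w)/n_w` for `x ∈ F₀^×`; with §1 and the isometry of `ℚ_p`-embeddings
  (S8 `norm_map_algHom`): **`ofUltrametric_mulLogvol_of_root`** — if the centre `c` of a `p`-adic field
  factor `K ⊇ (F₀)_w` satisfies `‖c‖^{2l}·‖j‖ = 1` (`c` = a `2l`-th root of the `q`-parameter up to a unit: `‖q_v‖ = ‖j_E‖_v⁻¹`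
  at a place of multiplicative reduction, [IUTchI] Ex. 3.2 (iv) `q̲_v̲`, [IUTchIV] Prop. 1.8 proof), then
  `μ̇^log_K(c) = [K:ℚ_p]·ord_w(j)·log N(w)/(2l·n_w)` — the hypothesis (hbad) of `isSettingOf_ofFrames` in its degree-weighted
  form (w5-d158) with `d := [K:ℚ_p]`, `Pr(w) := n_w`.
* §3 `sum_fiber_packetWeightTensor_mul_degree` — Mochizuki's VERBATIM normalized weights ([IUTchIII] Rmk. 3.1.1 (ii) p. 94,
  abc-iut-L6-t4 `packetWeightTensor`; = Dupuy–Hilado's by c312-6 `verbatim_weight_eq_dh_weight`) satisfy the marginal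
  identity (hmarg): for field factors `k` of the `(r+1)`-fold tensor packet at `p`, fibred over tuples `v⃗` of places of
  `F_mod` over `p` with `Σ_{k ∈ v⃗} d_k = dim_{ℚ_p} ⊗_a K_{v̲_a}`, `Σ_{k : v_r(k) = w} w_k·d_k = n_w / Σ_{w'|p} n_{w'}`
  (`= n_w/[F_mod:ℚ]`, `sum_localDeg`) — c312-6 `sum_factors_eq_sum_places` against the indicator of `w`.
* §4 **`isSettingOf_ofFrames_verbatim`** — the capstone: `IsSettingOf D (Setting.ofFrames …)` for frame volume pieces whose
  field factors at every NONARCHIMEDEAN `v_ℚ` are fibred over place-tuples with verbatim weights and whose `q`-centre has the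
  factorwise log-volume of §2 at a bad last place (`d_k·ord_w(j)·log N(w)/(2l·n_w)`), `0` at a good one, and `0` at the
  archimedean packets (unit centre) — no free `π`/`Pr`/`gm`-junk: the place of a factor is the LAST coordinate of its tuple
  (the `q`-pilot acts in the tensor slot labelled `j` — the reading modelled by c312-6's `sum_factors_eq_sum_places`),
  `Pr := n_w`, and the prime-below map is tied to the primes by `hgm`.
What remains for the assembler (c312-3 / c312-5 / c312-7-successor) is DEFINITIONAL: that its `V.w` IS `packetWeightTensor`,
its `V.vol` IS `FactorVolume.ofUltrametric` on `ℚ_p`-algebra factors with `Σ finrank = dim` per summand, and its `qCentre`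
IS a `2l`-th root of the `q`-parameter at `v̲ ∈ V̲^bad` (abc-iut-L5-t2 `BadLocalFrobenioid.qroot`) and a unit elsewhere —
then §1–§2 turn (hbad) into `rfl`-level facts. [claim: Mochizuki2012, status: disputed] for every quotation; everything
proved here is local-field arithmetic and finite-sum bookkeeping. Classical background: Neukirch ANT II (4.8), (6.8), (8.5).
-/

noncomputable section

namespace Summit.ABC.IUTFork.Cor312Prov

open Literature.IUT.HodgeTheaters Literature.IUT.LogVolume Literature.IUT.LogThetaLattice NumberField IsDedekindDomain
open Literature.NumberTheory.NumberFields
open Thm311 Cor312 Cor312Vol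
open scoped Classical

/-! ## 1. The Haar factor log-volume of a centre: `μ̇^log_K(c) = [K:ℚ_p]·log ‖c‖` -/

section Haar

variable (p : ℕ) [Fact p.Prime] (K : Type) [NontriviallyNormedField K] [NormedAlgebra ℚ_[p] K]
  [IsUltrametricDist K] [ProperSpace K] [MeasurableSpace K] [BorelSpace K]

/-- **`μ̇^log_K(c) = [K:ℚ_p]·log ‖c‖`** for the Haar factor volume (`μ(𝒪_K) = 1`) of a `p`-adic field `K` (norm-side class:
`‖p‖ = p⁻¹`): [AbsTopIII] Prop. 5.7 (i)(b) `μ̇^log(c) = −ord(c)·log q_K` rewritten through `e·f = [K:ℚ_p]`.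
[cite: MochizukiAbsTopIII2015, Prop. 5.7 (i)(b) p. 138] -/
theorem ofUltrametric_mulLogvol_eq_finrank_mul_log {c : K} (hc : c ≠ 0) :
    (FactorVolume.ofUltrametric K).mulLogvol c = (Module.finrank ℚ_[p] K : ℝ) * Real.log ‖c‖ := by
  have h1 := FactorVolume.ofUltrametric_mulLogvol K (Units.mk0 c hc)
  rw [Units.val_mk0] at h1
  rw [h1, mulLogVolume_eq_mul_log_norm p K (Units.mk0 c hc), Units.val_mk0, ← Nat.cast_mul,
    absRamificationIdx_mul_residueDegree p K]

/-- … hence, if `‖c‖^N·‖y‖ = 1` (`N ≠ 0`; `c` "an `N`-th root of `y⁻¹` up to a unit"), `μ̇^log_K(c) = −([K:ℚ_p]/N)·log ‖y‖`.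
[cite: MochizukiAbsTopIII2015, Prop. 5.7 (i)(b) p. 138] -/
theorem ofUltrametric_mulLogvol_of_norm_pow_mul_norm_eq_one {c y : K} (hc : c ≠ 0) {N : ℕ} (hN : N ≠ 0)
    (h : ‖c‖ ^ N * ‖y‖ = 1) :
    (FactorVolume.ofUltrametric K).mulLogvol c = -((Module.finrank ℚ_[p] K : ℝ) * Real.log ‖y‖) / N := by
  rw [ofUltrametric_mulLogvol_eq_finrank_mul_log p K hc]
  have hcpos : 0 < ‖c‖ := norm_pos_iff.mpr hc
  have hy : ‖y‖ = (‖c‖ ^ N)⁻¹ := eq_inv_of_mul_eq_one_right h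
  rw [hy, Real.log_inv, Real.log_pow]
  have hN' : (N : ℝ) ≠ 0 := by exact_mod_cast hN
  field_simp

end Haar

/-! ## 2. The norm of `j` in the rescaled completion and the log-volume of a `2l`-th root of the `q`-parameter -/

section Root

variable (F₀ : Type) [Field F₀] [NumberField F₀] (p : ℕ) (w : HeightOneSpectrum (𝓞 F₀))
  (hw : ((p : ℕ) : 𝓞 F₀) ∈ w.asIdeal)

/-- **`log ‖x‖_{(F₀)_w} = −ord_w(x)·log N(w)/n_w`** in abc-iut-S7's rescaled completion (`‖·‖ = ‖·‖_w^{1/n_w}`,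
`‖x‖_w = N(w)^{−ord_w(x)}` Mathlib's normalised absolute value, `n_w = e_w·f_w = [(F₀)_w:ℚ_p]`), for `x ∈ F₀^×` — Dupuy–Hilado's
conversion formula "`ln|a_v|_p = −deĝ(ord_v(a_v)[v])/[F_{0,v}:ℚ_p]`". [cite: DupuyHilado2025, §2.5.5] -/
theorem log_norm_rescaledCompletion_embedding {x : F₀} (hx : x ≠ 0) :
    Real.log ‖RescaledCompletion.of F₀ p w hw (FinitePlace.embedding w x)‖ =
      -(ord F₀ w x : ℝ) * logNorm F₀ w / (localDeg F₀ w : ℝ) := by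
  rw [RescaledCompletion.norm_of, FinitePlace.norm_embedding, adicAbv_eq_absNorm_zpow F₀ w hx]
  have hN : (0 : ℝ) < (Ideal.absNorm w.asIdeal : ℝ) := by
    exact_mod_cast Nat.lt_trans Nat.zero_lt_one (NumberField.HeightOneSpectrum.one_lt_absNorm w)
  rw [Real.log_rpow (zpow_pos hN _), Real.log_zpow]
  unfold logNorm
  push_cast
  ring

variable {F₀ p w hw}

/-- **The Haar log-volume of a `2l`-th root of the `q`-parameter in a field factor over `(F₀)_w`.** For a `p`-adic field
factor `K` receiving a `ℚ_p`-embedding `σ` of `(F₀)_w` (an isometry, S8 `norm_map_algHom`) and a centre `c ∈ K^×` with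
`‖c‖^N·‖σ(j)‖ = 1` (`N = 2l`, `j ∈ F₀^×`: "`c` is an `N`-th root of the `q`-parameter up to a unit", `‖q_v‖ = ‖j‖_v⁻¹`):
`μ̇^log_K(c) = [K:ℚ_p]·ord_w(j)·log N(w)/(N·n_w)` — hypothesis (hbad) of `isSettingOf_ofFrames` in degree-weighted form with
`d := [K:ℚ_p]`, `Pr(w) := n_w` ([IUTchIV] p. 23 "`|log(q)| = (1/2l)·log(q)`", local content).
[claim: Mochizuki2012, status: disputed] -/
theorem ofUltrametric_mulLogvol_of_root [Fact p.Prime] (K : Type) [NontriviallyNormedField K]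
    [NormedAlgebra ℚ_[p] K] [IsUltrametricDist K] [ProperSpace K] [MeasurableSpace K] [BorelSpace K]
    (σ : RescaledCompletion F₀ p w hw →ₐ[ℚ_[p]] K) {x : F₀} (hx : x ≠ 0) {c : K} (hc : c ≠ 0) {N : ℕ} (hN : N ≠ 0)
    (hroot : ‖c‖ ^ N * ‖σ (RescaledCompletion.of F₀ p w hw (FinitePlace.embedding w x))‖ = 1) :
    (FactorVolume.ofUltrametric K).mulLogvol c =
      (Module.finrank ℚ_[p] K : ℝ) * ((ord F₀ w x : ℝ) * logNorm F₀ w / (N * localDeg F₀ w)) := by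
  rw [ofUltrametric_mulLogvol_of_norm_pow_mul_norm_eq_one p K hc hN hroot, norm_map_algHom σ,
    log_norm_rescaledCompletion_embedding F₀ p w hw hx]
  have hN' : (N : ℝ) ≠ 0 := by exact_mod_cast hN
  have hn : (localDeg F₀ w : ℝ) ≠ 0 := by exact_mod_cast (localDeg_pos F₀ w).ne'
  field_simp

/-- … in the shape consumed by `isSettingOf_ofFrames_verbatim` (`N := 2l`): `μ̇^log_K(c) = [K:ℚ_p]·(ord_w(j)·log N(w)/(2l·n_w))`.
[claim: Mochizuki2012, status: disputed] -/
theorem ofUltrametric_mulLogvol_of_root_two_mul [Fact p.Prime] (K : Type) [NontriviallyNormedField K]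
    [NormedAlgebra ℚ_[p] K] [IsUltrametricDist K] [ProperSpace K] [MeasurableSpace K] [BorelSpace K]
    (σ : RescaledCompletion F₀ p w hw →ₐ[ℚ_[p]] K) {x : F₀} (hx : x ≠ 0) {c : K} (hc : c ≠ 0) {l : ℕ} (hl : l ≠ 0)
    (hroot : ‖c‖ ^ (2 * l) * ‖σ (RescaledCompletion.of F₀ p w hw (FinitePlace.embedding w x))‖ = 1) :
    (FactorVolume.ofUltrametric K).mulLogvol c =
      (Module.finrank ℚ_[p] K : ℝ) * ((ord F₀ w x : ℝ) * logNorm F₀ w / (2 * (l : ℝ) * localDeg F₀ w)) := by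
  rw [ofUltrametric_mulLogvol_of_root K σ hx hc (by omega : 2 * l ≠ 0) hroot]
  push_cast
  ring

end Root

/-! ## 3. The verbatim weights satisfy the marginal identity (hmarg) -/

section Weights

/-- **Marginal identity for Mochizuki's verbatim weights.** Field factors `k : J` of the `(r+1)`-fold tensor packet over `p`,
fibred (onto) by `t` over tuples `v⃗ : Fin (r+1) → W` of places of `F_mod` over `p` (`W ≠ ∅`), with positive "degrees" `d_k`
adding up over each tuple to `dim_{ℚ_p}(⊗_a K_{v̲_a}) = Π_a [K_{v̲_a}:(F_mod)_{v_a}]·[(F_mod)_{v_a}:ℚ_p]` (`hdim`) and the weight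
of [IUTchIII] Rmk. 3.1.1 (ii) p. 94 (`packetWeightTensor degF degKF v⃗`, the weight of the summand containing `k`): then for
every place `w | p`, `Σ_{k : v_r(k) = w} w_k·d_k = degF(w) / Σ_{w'} degF(w')` — the `q`-pilot sits in the LAST tensor slot, so
only the last coordinate of the tuple is seen (c312-6 `sum_factors_eq_sum_places` against the indicator of `w`).
[claim: Mochizuki2012, status: disputed] -/
theorem sum_fiber_packetWeightTensor_mul_degree {J W : Type*} [Fintype J] [Fintype W] [DecidableEq W] [Nonempty W]
    (r : ℕ) (t : J → (Fin (r + 1) → W)) (ht : Function.Surjective t) (degF degKF : W → ℕ+) (d : J → ℝ)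
    (hd : ∀ k, 0 < d k)
    (hdim : ∀ k, ∑ k' ∈ Finset.univ.filter (fun k' => t k' = t k), d k' =
      ∏ a, ((degKF (t k a) : ℝ) * (degF (t k a) : ℝ)))
    (w : W) :
    ∑ k ∈ Finset.univ.filter (fun k => t k (Fin.last r) = w), packetWeightTensor degF degKF (t k) * d k =
      (degF w : ℝ) / ∑ w', (degF w' : ℝ) := by
  have hS : (0 : ℝ) < ∑ w', (degF w' : ℝ) :=
    Finset.sum_pos (fun w' _ => by exact_mod_cast (degF w').pos) Finset.univ_nonempty
  have hP : ∑ v, (fun v : W => (degF v : ℝ) / ∑ w', (degF w' : ℝ)) v = 1 := by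
    rw [← Finset.sum_div]
    exact div_self hS.ne'
  have key := sum_factors_eq_sum_places r t ht d (fun k => packetWeightTensor degF degKF (t k))
    (fun k => d k * if t k (Fin.last r) = w then 1 else 0) (fun v : W => (degF v : ℝ) / ∑ w', (degF w' : ℝ))
    (fun v => if v = w then 1 else 0) hd hP
    (fun k => by rw [hdim k]; exact verbatim_weight_eq_dh_weight degF degKF (t k)) (fun k => rfl)
  rw [Finset.sum_filter]
  have hl : ∀ k, (if t k (Fin.last r) = w then packetWeightTensor degF degKF (t k) * d k else 0) =
      packetWeightTensor degF degKF (t k) * (d k * if t k (Fin.last r) = w then 1 else 0) := fun k => by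
    split_ifs <;> simp
  simp_rw [hl, key, mul_ite, mul_one, mul_zero, Finset.sum_ite_eq', Finset.mem_univ, if_true]

/-- The same against the local degrees `n_w` of the places of `F_mod` over `p` (`degF w := n_w`, `Σ_{w|p} n_w = [F_mod:ℚ]`,
`sum_localDeg`): `Σ_{k : v_r(k) = w} w_k·d_k = n_w/[F_mod:ℚ]` — hypothesis (hmarg) of `isSettingOf_ofFrames` in degree-weighted
form with `Pr(w) := n_w`. [claim: Mochizuki2012, status: disputed] -/
theorem sum_fiber_packetWeightTensor_mul_degree_localDeg (F₀ : Type) [Field F₀] [NumberField F₀] (p : ℕ) [Fact p.Prime]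
    {J : Type*} [Fintype J] (r : ℕ) (t : J → (Fin (r + 1) → ↥(placesOver F₀ p))) (ht : Function.Surjective t)
    (degKF : ↥(placesOver F₀ p) → ℕ+) (d : J → ℝ) (hd : ∀ k, 0 < d k)
    (hdim : ∀ k, ∑ k' ∈ Finset.univ.filter (fun k' => t k' = t k), d k' =
      ∏ a, ((degKF (t k a) : ℝ) * (localDeg F₀ (t k a).1 : ℝ)))
    (w : ↥(placesOver F₀ p)) :
    ∑ k ∈ Finset.univ.filter (fun k => t k (Fin.last r) = w),
        packetWeightTensor (fun w' : ↥(placesOver F₀ p) => ⟨localDeg F₀ w'.1, localDeg_pos F₀ w'.1⟩) degKF (t k) * d k =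
      (localDeg F₀ w.1 : ℝ) / Module.finrank ℚ F₀ := by
  haveI : Nonempty ↥(placesOver F₀ p) :=
    let ⟨v, hv⟩ := placesOver_nonempty F₀ p
    ⟨⟨v, hv⟩⟩
  have h := sum_fiber_packetWeightTensor_mul_degree r t ht
    (fun w' : ↥(placesOver F₀ p) => ⟨localDeg F₀ w'.1, localDeg_pos F₀ w'.1⟩) degKF d hd
    (fun k => by rw [hdim k]; rfl) w
  rw [h]
  congr 1
  rw [← sum_localDeg F₀ p, Nat.cast_sum]
  exact Finset.sum_coe_sort (placesOver F₀ p) (fun x => (localDeg F₀ x : ℝ))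

end Weights

/-! ## 4. The capstone: `IsSettingOf D (Setting.ofFrames …)` from the genuine local data -/

section Capstone

variable {F K Fbar : Type} [Field F] [NumberField F] [Field K] [NumberField K]
  [Algebra F K] [Field Fbar] [Algebra F Fbar] [Algebra K Fbar] {E : WeierstrassCurve F} [E.IsElliptic]
  {l : ℕ} {Pb : BadPlacePredicates K}

/-- **`IsSettingOf D P` for the assembled real setting over volume frames, from the GENUINE local data** ([IUTchIII]
Rmk. 3.1.1 (ii) verbatim weights × [AbsTopIII] Prop. 5.7 (i) Haar log-volumes of the `2l`-th root of the `q`-parameter;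
[IUTchIV] p. 23 "`|log(q)| = (1/2l)·log(q)`"). Over abc-iut-c312-7's `Setting.ofFrames` with abc-iut-c312-6's
`FrameVolumePieces V` realized by the line data: IF at every nonarchimedean `v_ℚ` (prime `p(v_ℚ)`, tied to the prime-below
map `gm` by `hgm`) the field factors `k` of the packet at label `j` are fibred (`t`, onto) over tuples
`v⃗ : Fin (r+1) → V(F_mod)_{p(v_ℚ)}` with positive degrees `d_k` adding up over each tuple to
`Π_a [K_{v̲_a}:(F_mod)_{v_a}]·n_{v_a}` (`hdim`), the weight of `k` IS Mochizuki's normalized weight of its tuple (`hw`,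
`packetWeightTensor` with `degF := n_w`), and the factorwise log-volume of the `q`-pilot centre is
`d_k·ord_w(j_E)·log N(w)/(2l·n_w)` when the LAST place `w = v_r(k)` of the tuple is bad (`hbad` — §2
`ofUltrametric_mulLogvol_of_root` for a `2l`-th root of `q` in a Haar-measured `ℚ_p`-algebra factor), `0` when
it is good (`hgood`, unit centre) and `0` at every archimedean packet (`harch`), THEN `IsSettingOf D P`: the setting is over
`D`'s index skeleton and its `−|log(q)|` is `−(1/2l)·log(q)` of `D`. PROVED: §3 marginal identity + `Cor312ProvenanceMod`
(`negLogQ_eq_neg_absLogq_of_pieces_mod` with `wd := w·d`, `Pr := n_w`, pieces := the factors at nonarchimedean `v_ℚ`).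
The binders `lat`/`sig`/`split`/`qData`/`thetaBox`/`hq`/`hadm`/`hfin` of `Setting.ofFrames` are untouched.
[claim: Mochizuki2012, status: disputed] -/
theorem isSettingOf_ofFrames_verbatim (D : InitialThetaData F K Fbar E l Pb)
    {S : Situation (Thm311.Real.thetaIndexOfInitial D)} {V : FrameVolumePieces S.L} {n : ℤ}
    {HT : Type} {LogLink : HT → HT → Type} {IsFull : ∀ {s t : HT}, LogLink s t → Prop}
    (lat : LGPGaussianLogThetaLattice LogLink IsFull)
    {Frd : Type} {IsoF : Frd → Frd → Type} {Ob : Frd → Type} {realify : Frd → Frd} {Strip : Type}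
    {IsoS : Strip → Strip → Type} {M : ∀ v : (Thm311.Real.thetaIndexOfInitial D).V,
      v ∈ (Thm311.Real.thetaIndexOfInitial D).Vbad → Type} [∀ v h, Monoid (M v h)]
    (sig : GlobalLGPFrobenioidSignature (Thm311.Real.thetaIndexOfInitial D).lstar (Thm311.Real.thetaIndexOfInitial D).V
      (· ∈ (Thm311.Real.thetaIndexOfInitial D).Vbad) Frd IsoF Ob realify Strip IsoS M)
    (split : SplittingMonoids M) {ObΔ : Type} {N : ∀ v : (Thm311.Real.thetaIndexOfInitial D).V,
      v ∈ (Thm311.Real.thetaIndexOfInitial D).Vbad → Type} [∀ v h, Monoid (N v h)]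
    (qData : QPilotData ObΔ N)
    (thetaBox : ℤ → Ob sig.Clgp → ∀ j vQ, Set (∀ i, V.K j vQ i))
    (qCentre : ObΔ → ∀ j vQ, ∀ i, V.K j vQ i)
    (hq : ∀ j vQ i, qCentre (qPilotObject qData) j vQ i ≠ 0)
    (hadm : ∀ j vQ (H : Set (∀ i, V.K j vQ i)), IsHullSet (V.K j vQ) H → (S.D n).Adm j vQ (V.e j vQ ⁻¹' H))
    (hfin : ∀ j : (Thm311.Real.thetaIndexOfInitial D).Label, (Function.support fun vQ => (S.D n).logvol j vQ
      (V.e j vQ ⁻¹' hullSet (V.K j vQ) (qCentre (qPilotObject qData) j vQ))).Finite)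
    (hV : V.Realizes (S.D n))
    (jm : fieldOfModuli E) (hjm : (jm : F) = E.j)
    -- the primes below the nonarchimedean `v_ℚ`, tied to the prime-below map on the finite places of `F_mod`
    (p : (Thm311.Real.thetaIndexOfInitial D).VQ → ℕ) [∀ vQ, Fact (p vQ).Prime]
    (gm : FinitePlace (fieldOfModuli E) → (Thm311.Real.thetaIndexOfInitial D).VQ)
    (hgm : ∀ w vQ, gm w = vQ ↔ (Thm311.Real.thetaIndexOfInitial D).IsNon vQ ∧
      ((p vQ : ℕ) : 𝓞 (fieldOfModuli E)) ∈ w.maximalIdeal.asIdeal)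
    -- relative degrees `[K_v̲ : (F_mod)_v]` of the chosen places (any positive naturals)
    (degKF : ∀ vQ, ↥(placesOver (fieldOfModuli E) (p vQ)) → ℕ+)
    -- at nonarchimedean `v_ℚ`: field factors fibred over tuples of places over `p(v_ℚ)`; degrees; dimension count; weights
    (r : (Thm311.Real.thetaIndexOfInitial D).Label → (Thm311.Real.thetaIndexOfInitial D).VQ → ℕ)
    (t : ∀ j vQ, (Thm311.Real.thetaIndexOfInitial D).IsNon vQ → V.J j vQ →
      (Fin (r j vQ + 1) → ↥(placesOver (fieldOfModuli E) (p vQ))))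
    (ht : ∀ j vQ hn, Function.Surjective (t j vQ hn))
    (d : ∀ (j : (Thm311.Real.thetaIndexOfInitial D).Label) (vQ : (Thm311.Real.thetaIndexOfInitial D).VQ), V.J j vQ → ℝ)
    (hd : ∀ j vQ k, 0 < d j vQ k)
    (hdim : ∀ j vQ hn k, ∑ k' ∈ Finset.univ.filter (fun k' => t j vQ hn k' = t j vQ hn k), d j vQ k' =
      ∏ a, ((degKF vQ (t j vQ hn k a) : ℝ) * (localDeg (fieldOfModuli E) (t j vQ hn k a).1 : ℝ)))
    (hw : ∀ j vQ hn k, V.w j vQ k = packetWeightTensor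
      (fun w' : ↥(placesOver (fieldOfModuli E) (p vQ)) => ⟨localDeg (fieldOfModuli E) w'.1, localDeg_pos _ w'.1⟩)
      (degKF vQ) (t j vQ hn k))
    -- the `q`-centre: factorwise log-volume of a `2l`-th root of `q` at a bad last place, `0` at a good one / archimedean
    (hbad : ∀ j vQ hn k, FinitePlace.mk (t j vQ hn k (Fin.last _)).1 ∈ D.VbadMod →
      (V.vol j vQ k).mulLogvol (qCentre (qPilotObject qData) j vQ k) =
        d j vQ k * ((ord (fieldOfModuli E) (t j vQ hn k (Fin.last _)).1 jm : ℝ) *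
          logNorm (fieldOfModuli E) (t j vQ hn k (Fin.last _)).1 /
            (2 * (l : ℝ) * localDeg (fieldOfModuli E) (t j vQ hn k (Fin.last _)).1)))
    (hgood : ∀ j vQ hn k, FinitePlace.mk (t j vQ hn k (Fin.last _)).1 ∉ D.VbadMod →
      (V.vol j vQ k).mulLogvol (qCentre (qPilotObject qData) j vQ k) = 0)
    (harch : ∀ j vQ, ¬ (Thm311.Real.thetaIndexOfInitial D).IsNon vQ → ∀ k,
      (V.vol j vQ k).mulLogvol (qCentre (qPilotObject qData) j vQ k) = 0) :
    IsSettingOf D (Setting.ofFrames n lat sig split qData (V.toRealFrames thetaBox qCentre) hq hadm hfin) := by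
  refine isSettingOf_ofInitial D _ ?_
  refine negLogQ_eq_neg_absLogq_of_pieces_mod D jm hjm _ gm
    (fun w => (localDeg (fieldOfModuli E) w.maximalIdeal : ℝ))
    (fun w _ => by exact_mod_cast (localDeg_pos (fieldOfModuli E) w.maximalIdeal).ne')
    (fun i vQ => {k : V.J (Setting.labelSucc i) vQ // (Thm311.Real.thetaIndexOfInitial D).IsNon vQ})
    (fun i vQ x => FinitePlace.mk (t (Setting.labelSucc i) vQ x.2 x.1 (Fin.last _)).1)
    (fun i vQ x => (hgm _ vQ).mpr ⟨x.2, by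
      -- `p(v_ℚ)` lies in the last place of the tuple (a place over `p(v_ℚ)`; cf. `Summit.ABC.IUTFork.natCast_mem_of_mem_placesOver`)
      have h := (mem_placesOver_iff_residueChar _).mp (t (Setting.labelSucc i) vQ x.2 x.1 (Fin.last _)).2
      have h2 := natCast_residueChar_mem (fieldOfModuli E) (t (Setting.labelSucc i) vQ x.2 x.1 (Fin.last _)).1
      rw [h] at h2
      rw [FinitePlace.maximalIdeal_mk]
      exact h2⟩)
    (fun i vQ x => V.w (Setting.labelSucc i) vQ x.1 * d (Setting.labelSucc i) vQ x.1)
    (fun i vQ x => if FinitePlace.mk (t (Setting.labelSucc i) vQ x.2 x.1 (Fin.last _)).1 ∈ D.VbadMod then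
      -(-(ord (fieldOfModuli E) (FinitePlace.mk (t (Setting.labelSucc i) vQ x.2 x.1 (Fin.last _)).1).maximalIdeal jm : ℝ) *
          logNorm (fieldOfModuli E) (FinitePlace.mk (t (Setting.labelSucc i) vQ x.2 x.1 (Fin.last _)).1).maximalIdeal) /
        (2 * (l : ℝ) *
          (localDeg (fieldOfModuli E) (FinitePlace.mk (t (Setting.labelSucc i) vQ x.2 x.1 (Fin.last _)).1).maximalIdeal : ℝ))
      else 0)
    ?_ (fun i vQ x hx => if_pos hx) (fun i vQ x hx => if_neg hx) ?_
  · -- (hmarg): the verbatim weights over the factors whose last place is `w` add up to `n_w/[F_mod:ℚ]` (§3)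
    intro i vQ w _ hgw
    obtain ⟨hn, hpw⟩ := (hgm w vQ).mp hgw
    have hw₀ : w.maximalIdeal ∈ placesOver (fieldOfModuli E) (p vQ) :=
      Cor22.mem_placesOver_of_natCast_mem (p vQ) _ hpw
    have hiff : ∀ x : {k : V.J (Setting.labelSucc i) vQ // (Thm311.Real.thetaIndexOfInitial D).IsNon vQ},
        FinitePlace.mk (t (Setting.labelSucc i) vQ x.2 x.1 (Fin.last _)).1 = w ↔
          t (Setting.labelSucc i) vQ hn x.1 (Fin.last _) = ⟨w.maximalIdeal, hw₀⟩ := by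
      intro x
      constructor
      · intro h
        apply Subtype.ext
        have h' := congrArg FinitePlace.maximalIdeal h
        rw [FinitePlace.maximalIdeal_mk] at h'
        exact h'
      · intro h
        have h' : (t (Setting.labelSucc i) vQ x.2 x.1 (Fin.last _)).1 = w.maximalIdeal := congrArg Subtype.val h
        rw [h', FinitePlace.mk_maximalIdeal]
    have hsum : ∑ x ∈ Finset.univ.filter (fun x : {k : V.J (Setting.labelSucc i) vQ //
          (Thm311.Real.thetaIndexOfInitial D).IsNon vQ} =>
          FinitePlace.mk (t (Setting.labelSucc i) vQ x.2 x.1 (Fin.last _)).1 = w),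
          V.w (Setting.labelSucc i) vQ x.1 * d (Setting.labelSucc i) vQ x.1 =
        ∑ k ∈ Finset.univ.filter (fun k => t (Setting.labelSucc i) vQ hn k (Fin.last _) = ⟨w.maximalIdeal, hw₀⟩),
          packetWeightTensor (fun w' : ↥(placesOver (fieldOfModuli E) (p vQ)) =>
            ⟨localDeg (fieldOfModuli E) w'.1, localDeg_pos _ w'.1⟩) (degKF vQ) (t (Setting.labelSucc i) vQ hn k) *
            d (Setting.labelSucc i) vQ k := by
      rw [Finset.sum_filter, Finset.sum_filter]
      refine Fintype.sum_equiv (Equiv.subtypeUnivEquiv fun _ => hn) _ _ fun x => ?_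
      rw [Equiv.subtypeUnivEquiv_apply, if_congr (hiff x) (by rw [hw _ vQ hn x.1]) rfl]
    rw [hsum]
    exact sum_fiber_packetWeightTensor_mul_degree_localDeg (fieldOfModuli E) (p vQ) (r _ vQ) (t _ vQ hn) (ht _ vQ hn)
      (degKF vQ) (d _ vQ) (hd _ vQ) (hdim _ vQ hn) ⟨w.maximalIdeal, hw₀⟩
  · -- (hq): the closed form of the local `q`-volume, factor by factor
    intro i vQ
    rw [FrameVolumePieces.qLocal_ofFrames lat sig split qData thetaBox qCentre hq hadm hfin hV (Setting.labelSucc i) vQ]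
    by_cases hn : (Thm311.Real.thetaIndexOfInitial D).IsNon vQ
    · refine (Fintype.sum_equiv (Equiv.subtypeUnivEquiv fun _ => hn) _ _ fun x => ?_).symm
      rw [Equiv.subtypeUnivEquiv_apply]
      by_cases hx : FinitePlace.mk (t (Setting.labelSucc i) vQ x.2 x.1 (Fin.last _)).1 ∈ D.VbadMod
      · rw [if_pos hx, hbad _ vQ x.2 x.1 hx]
        simp only [FinitePlace.maximalIdeal_mk]
        ring
      · rw [if_neg hx, hgood _ vQ x.2 x.1 hx, mul_zero, mul_zero]
    · haveI : IsEmpty {k : V.J (Setting.labelSucc i) vQ // (Thm311.Real.thetaIndexOfInitial D).IsNon vQ} :=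
        ⟨fun x => hn x.2⟩
      rw [Finset.univ_eq_empty (α := {k : V.J (Setting.labelSucc i) vQ // (Thm311.Real.thetaIndexOfInitial D).IsNon vQ}),
        Finset.sum_empty]
      exact Finset.sum_eq_zero fun k _ => by rw [harch _ vQ hn k, mul_zero]

end Capstone

end Summit.ABC.IUTFork.Cor312Prov

end
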